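import Literature.AlgebraicGeometry.HodgeTheory.WeilClassesSurfacesAlgebraic
import Literature.AlgebraicGeometry.HodgeTheory.WeilClassesSixfoldsProofs
import Literature.AlgebraicGeometry.Motives.AbelianVarietyCohomologyExteriorH1
import HarnessLib

/-!
# Crux `HeckePrymAnchors` (stmt-HodgeConjecture-14496), line `Sketch` v17 · stub S `stub_seedSurface`

Route `HeckePrymWeil`, continuation lead c11. The SEED of the chain of aimed products
(`seedChain` / `hyperbolicTargets` of the skeleton `Lines/Sketch.lean`): for every `p ≥ 1` a complex
abelian surface `(P, ψ)`, `ψ ≫ ψ = -p`, carrying a non-zero rational `(1,1)` class in its strong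
Weil plane `weilClassesOf P ψ 1 p`, the whole plane consisting of ALGEBRAIC classes.

Proof: the tree's `exists_weilType_abelianSurfaces_algebraic` (`HodgeTheory/WeilClassesSurfacesAlgebraic`:
the square `E × E` of an elliptic curve with `ψ(x, y) = (-p·y, x)`, its graph-divisor Weil class `b`,
rational of type `(1,1)`, algebraic, `b ⌣ b ≠ 0`) and "one non-zero algebraic Weil class makes the
whole strong Weil plane algebraic" (`weilClassesOf_le_algebraicClasses_iff_exists_ne_zero_of_dim_eq`,
`HodgeTheory/WeilClassesSixfoldsProofs`, fed with the discharged
`Motives.abelianVarietyCohomologyExteriorH1_holds`). No definition, no named fact, no `sorry`.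
-/

noncomputable section

-- every declaration of this problem lives in `Summit.HodgeConjecture.HodgeConjecture.…` (summit = sub-problem)
set_option linter.dupNamespace false

open CategoryTheory AlgebraicGeometry

namespace Summit.HodgeConjecture.HodgeConjecture.Theorems.HeckePrymWeilLine

open Literature.AlgebraicGeometry Literature.AlgebraicGeometry.Motives Literature.AlgebraicGeometry.HodgeTheory
open Literature.AlgebraicTopology.SingularHomology

/-- **Stub S (seed Weil surface)**: for `p ≥ 1` there is a complex abelian surface `(P, ψ)`,
`ψ ≫ ψ = -p`, with a non-zero rational `(1,1)` class in its strong Weil plane and algebraic strong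
Weil plane — the square of an elliptic curve with its graph-divisor Weil class
(`exists_weilType_abelianSurfaces_algebraic`), the plane being algebraic as soon as one non-zero
member is (`weilClassesOf_le_algebraicClasses_iff_exists_ne_zero_of_dim_eq`).
[cite: vanGeemen1994HodgeAV, 5.3 and proof of Thm. 6.12] -/
theorem stub_seedSurface :
    ∀ p : ℕ, 0 < p → ∃ (P : AbelianVariety ℂ) (ψ : P ⟶ P), P.dim = 2 * 1 ∧ ψ ≫ ψ = -(p • 𝟙 P) ∧
      (∃ c ∈ weilClassesOf P ψ 1 p, IsRationalClass c ∧ IsOfHodgeType (2 * 1) P.X (2 * 1) 1 1 c ∧ c ≠ 0) ∧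
      weilClassesOf P ψ 1 p ≤ algebraicClasses P.X 1 := by
  intro p hp
  obtain ⟨P, ψ, b, hP, hψ, hrat, hH, hbW, hbalg, hbb⟩ := exists_weilType_abelianSurfaces_algebraic p hp
  have hb0 : b ≠ 0 := by
    rintro rfl
    exact hbb (LinearMap.map_zero₂ _ _)
  have hP' : P.dim = 2 * 1 := by omega
  refine ⟨P, ψ, hP', hψ, ⟨b, hbW, hrat, hH, hb0⟩, ?_⟩
  exact (weilClassesOf_le_algebraicClasses_iff_exists_ne_zero_of_dim_eq
    Motives.abelianVarietyCohomologyExteriorH1_holds hP' one_pos hp hψ).2 ⟨b, hbW, hbalg, hb0⟩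

end Summit.HodgeConjecture.HodgeConjecture.Theorems.HeckePrymWeilLine

end
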